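import Mathlib.Analysis.SpecialFunctions.Pow.Real
import Mathlib.Algebra.BigOperators.Field

/-!
# EriceRemainderEnclosureHistoryAutonomyComparisonContinuumGaugeCost — (E127) **THE ALGEBRAIC CORE OF THE CONTINUUM LEVEL GAUGE: THE COST OF THE GAUGE
# `Z∕α` IS AT MOST `5∕8 + β̄∕4`.**  In the cell's CONTINUUM MODEL of the comparison column (`HOME/b2b-balaban-beta-d4-p2/g100/README.md` §2∕§5; this
# generation's `g101/README.md` §2) the linearised, level-matched response `Z` of a budgeted base (speed-at-level `Φ` non-increasing, blocks `(L_r, k_r)` with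
# window tops `ℓ_r(α) > α`, `Σ_r L_r ℓ_r^{-1∕2} ≤ Φ(α)`) to an admissible source obeys, wherever `Z ≥ 0` above and the gauge `Z(μ) ≤ (μ∕α)Z(α)` holds above,
#     `α·Z′ ≤ Z · COST`,   `COST = α·M∕Φ(α)² + Σ_r m_r K_r J_r ∕ Φ(α)`,
# with `m_r = (L_r∕2)ℓ_r^{-3∕2}Φ(ℓ_r) = (c_r∕2)·Φ(ℓ_r)∕ℓ_r` (`c_r = L_rℓ_r^{-1∕2}`), `M = Σ_r m_r`, `K_r = (3∕2)Φ(ℓ_r)∕ℓ_r + |Φ′(ℓ_r)|`, `J_r ≤ (ℓ_r² − α²)∕(2Φ(ℓ_r)²)`,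
# and `|Φ′(ℓ)| ≤ M(ℓ)∕Φ(ℓ) + (b′(ℓ))⁻` (floor `b = Φ − Σ L_rℓ_r^{-1∕2}`), `ℓ·M(ℓ) ≤ Φ(ℓ)²∕2` (the top bound, §2 here), `ℓ·(b′(ℓ))⁻ ≤ β̄·Φ(ℓ)` (floor steepness).
# THIS FILE is the finite, derivative-free part of that argument — pure real algebra over an abstract finite family of blocks: (**`K_le`**) the coefficient bound
# `K_r ≤ (2 + β̄)Φ(ℓ_r)∕ℓ_r`; (**`block_cost_le`**) PER BLOCK `α·m_r∕Φ² + m_rK_rJ_r∕Φ ≤ (c_r∕Φ)·(5∕8 + β̄∕4)` (the speed ratio `Φ(ℓ_r)∕Φ(α)` cancels exactly; `(1 + x −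
# x²)∕2 ≤ 5∕8`, `x = α∕ℓ_r`); (**`top_le_half`**) `α·M∕Φ² ≤ 1∕2` from the budget; (**`cost_le`**) `COST ≤ 5∕8 + β̄∕4` from the budget; (**`gauge_deriv_le`**,
# **`gauge_decreasing`**) from the derivative identity of `Z` (README §2 (1)), the sign facts and the window bounds: `α·Z′ ≤ Z·COST` and hence `α·Z′ − Z ≤
# −(3∕8 − β̄∕4)·Z` — the gauge `Z∕α` strictly decreases while `Z > 0` as soon as `β̄ < 3∕2`.  The continuous induction that turns this into LINEAR POSITIVITY (and,
# by the amplitude homotopy, into (E58′) for soft `u_0`-excesses at every amplitude in the continuum model) is README §2 (4)∕§3 and is NOT typed here (it needs the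
# calculus of the delay equation); the lattice analogue is (E118e) `…ComparisonNonlinearLevelGauge` (constant excess, cost `0.95` with discretisation defects).

Cell `pub-balaban`, β-function sub-cell, BINDER row D4 «RemainderConst leaves for Bałaban's split» (`HOME/BINDER-OWNERS.md`; owner lineage `b2b-balaban-beta-an4`;
this file by co-owner #2 lineage `b2b-balaban-beta-d4-p2`, generation 101), β-FLOW TEAM duty (1), FREEZE (0) honoured (def-free; imports Mathlib only; restates nothing).

HONEST FRAMING (page 1, verbatim and binding).  *"Discharging BetaPertH makes Bałaban's UV stability UNCONDITIONAL — a real constructive-QFT result; it is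
NOT the continuum limit and NOT the Clay problem."*  THIS FILE DISCHARGES NOTHING OF THE KIND.  Elementary real algebra about ABSTRACT finite families of reals
standing for the blocks of the cell's continuum model of an abstract flow with memory — hypotheses of a census, not facts; the form, signs, ages and moments of
Bałaban's (1.22) limit functional are NOT PRINTED ([I] p. 298; GAPS G-t4-U2-1∕-2) and NOT asserted.  Row D4 class UNCHANGED (critical-path width 0; instance 0∕1;
D4 DISCHARGE NO DATE).  HONEST DEPENDENCY: continuum YM on T⁴ ⇐ BetaPertH ∧ nine spine estimates (0/9 proved); BetaPertH ⇐ (D1) ∧ (D4) ∧ CAP+tail; G-an2-4 gates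
asym, D1 and NE2/3/4.  NOT CLAIMED: the lattice statement (E58′) for steep large excesses, sharp steps (README §5), anything printed — NOT B12 Thm 2, NOT BetaPertH,
NOT continuum, NOT Clay.

WHAT IS PROVED ([folklore]; 0 `def`, 0 sorry).  §1 `quad_le`, **`K_le`**, **`block_cost_le`**.  §2 **`top_le_half`**, **`cost_le`**.  §3 **`gauge_deriv_le`**,
**`gauge_decreasing`**.  v1.1 (same unit and generation) APPENDS §4 `quad_le_gen`, **`block_cost_le_gen`** — the per-block cost with a GENERAL coefficient `K ≤ κ·Φt∕ℓ`
(`κ = 2 + β̄` above; `κ = p′ + 3∕2 + β̄` for the extra kernel block of a soft `u_J`-onset, README §3 (e)): `≤ (c∕Φ)·(κ∕4 + 1∕(4κ))` — and modifies NO existing declaration.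
-/

noncomputable section
open Finset

namespace Summit.QuantumFields.BalabanUV.Beta.EriceRemainderEnclosureHistoryAutonomyComparisonContinuumGaugeCost

/-! ## §1 One block -/

/-- `x∕2 + (2+β)(1−x²)∕4 ≤ 5∕8 + β∕4` for `β ≥ 0` (because `(1 + x − x²)∕2 ≤ 5∕8`, i.e. `(2x−1)² ≥ 0`, and `β(1−x²) ≤ β`). [folklore] -/
theorem quad_le {x β : ℝ} (hβ : 0 ≤ β) : x / 2 + (2 + β) * (1 - x ^ 2) / 4 ≤ 5 / 8 + β / 4 := by
  nlinarith [sq_nonneg (2 * x - 1), mul_nonneg hβ (sq_nonneg x)]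

/-- **THE COEFFICIENT BOUND.**  At a window top of level `ℓ` with speed `Φt`: if the memory derivative there satisfies the top bound `ℓ·Mt ≤ Φt²∕2` and the
floor's decrease rate `bneg` satisfies `ℓ·bneg ≤ β·Φt`, then `K ≤ (3∕2)Φt∕ℓ + Mt∕Φt + bneg` gives `K ≤ (2+β)·Φt∕ℓ`. [folklore] -/
theorem K_le {ℓ Φt Mt bneg β K : ℝ} (hℓ : 0 < ℓ) (hΦt : 0 < Φt) (hM : ℓ * Mt ≤ Φt ^ 2 / 2) (hb : ℓ * bneg ≤ β * Φt)
    (hK : K ≤ 3 / 2 * Φt / ℓ + Mt / Φt + bneg) : K ≤ (2 + β) * Φt / ℓ := by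
  have h1 : Mt / Φt ≤ Φt / (2 * ℓ) := by
    rw [div_le_div_iff₀ hΦt (by positivity)]
    nlinarith
  have h2 : bneg ≤ β * Φt / ℓ := by
    rw [le_div_iff₀ hℓ]; linarith [mul_comm ℓ bneg]
  calc K ≤ 3 / 2 * Φt / ℓ + Mt / Φt + bneg := hK
    _ ≤ 3 / 2 * Φt / ℓ + Φt / (2 * ℓ) + β * Φt / ℓ := by linarith
    _ = (2 + β) * Φt / ℓ := by field_simp; ring

/-- **THE COST OF ONE BLOCK.**  Pin level `α > 0`, speed `Φa` there; block top `ℓ ≥ α` with speed `0 < Φt ≤ Φa`; share numerator `c ≥ 0` (`= L·ℓ^{-1∕2}`), kernel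
weight `m = (c∕2)·Φt∕ℓ` (`= (L∕2)ℓ^{-3∕2}Φ(ℓ)`), coefficient `K ≤ (2+β)Φt∕ℓ` (`K_le`), window integral `0 ≤ J ≤ (ℓ² − α²)∕(2Φt²)` (`∫_α^ℓ μΦ(μ)^{-2}dμ` with `Φ ≥ Φt`
on the window).  Then `α·m∕Φa² + m·K·J∕Φa ≤ (c∕Φa)·(5∕8 + β∕4)` — the speed ratio `Φt∕Φa` cancels in the second term and only helps in the first. [folklore] -/
theorem block_cost_le {α ℓ Φa Φt c m K J β : ℝ} (hα : 0 < α) (hαℓ : α ≤ ℓ) (hΦt : 0 < Φt) (hΦta : Φt ≤ Φa) (hc : 0 ≤ c) (hβ : 0 ≤ β)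
    (hm : m = c / 2 * (Φt / ℓ)) (hK : K ≤ (2 + β) * Φt / ℓ) (hJ0 : 0 ≤ J) (hJ : J ≤ (ℓ ^ 2 - α ^ 2) / (2 * Φt ^ 2)) :
    α * m / Φa ^ 2 + m * K * J / Φa ≤ c / Φa * (5 / 8 + β / 4) := by
  have hℓ : 0 < ℓ := lt_of_lt_of_le hα hαℓ
  have hΦa : 0 < Φa := lt_of_lt_of_le hΦt hΦta
  have hm0 : 0 ≤ m := by rw [hm]; positivity
  -- first term: α m ∕ Φa² = (c∕Φa)(α∕(2ℓ))·(Φt∕Φa) ≤ (c∕Φa)(α∕(2ℓ))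
  have h1 : α * m / Φa ^ 2 ≤ c / Φa * (α / (2 * ℓ)) := by
    have e1 : α * m / Φa ^ 2 = c / Φa * (α / (2 * ℓ)) * (Φt / Φa) := by
      rw [hm]; field_simp
    rw [e1]
    calc c / Φa * (α / (2 * ℓ)) * (Φt / Φa) ≤ c / Φa * (α / (2 * ℓ)) * 1 :=
          mul_le_mul_of_nonneg_left ((div_le_one hΦa).mpr hΦta) (by positivity)
      _ = c / Φa * (α / (2 * ℓ)) := mul_one _
  -- second term: m K J ∕ Φa ≤ m ((2+β)Φt∕ℓ) ((ℓ²−α²)∕(2Φt²)) ∕ Φa = (c∕Φa)(2+β)(1 − (α∕ℓ)²)∕4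
  have h2 : m * K * J / Φa ≤ c / Φa * ((2 + β) * (1 - (α / ℓ) ^ 2) / 4) := by
    have s1 : m * K * J ≤ m * ((2 + β) * Φt / ℓ) * J := by
      have := mul_le_mul_of_nonneg_left hK (mul_nonneg hm0 hJ0)
      nlinarith [this]
    have s2 : m * ((2 + β) * Φt / ℓ) * J ≤ m * ((2 + β) * Φt / ℓ) * ((ℓ ^ 2 - α ^ 2) / (2 * Φt ^ 2)) :=
      mul_le_mul_of_nonneg_left hJ (by positivity)
    have e2 : m * ((2 + β) * Φt / ℓ) * ((ℓ ^ 2 - α ^ 2) / (2 * Φt ^ 2)) / Φa = c / Φa * ((2 + β) * (1 - (α / ℓ) ^ 2) / 4) := by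
      rw [hm]; field_simp; ring
    calc m * K * J / Φa ≤ m * ((2 + β) * Φt / ℓ) * ((ℓ ^ 2 - α ^ 2) / (2 * Φt ^ 2)) / Φa :=
          div_le_div_of_nonneg_right (s1.trans s2) hΦa.le
      _ = c / Φa * ((2 + β) * (1 - (α / ℓ) ^ 2) / 4) := e2
  have h3 : α / (2 * ℓ) + (2 + β) * (1 - (α / ℓ) ^ 2) / 4 ≤ 5 / 8 + β / 4 := by
    have : α / (2 * ℓ) = (α / ℓ) / 2 := by field_simp
    rw [this]; exact quad_le hβ
  have hcΦ : 0 ≤ c / Φa := div_nonneg hc hΦa.le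
  calc α * m / Φa ^ 2 + m * K * J / Φa ≤ c / Φa * (α / (2 * ℓ)) + c / Φa * ((2 + β) * (1 - (α / ℓ) ^ 2) / 4) := add_le_add h1 h2
    _ = c / Φa * (α / (2 * ℓ) + (2 + β) * (1 - (α / ℓ) ^ 2) / 4) := by ring
    _ ≤ c / Φa * (5 / 8 + β / 4) := mul_le_mul_of_nonneg_left h3 hcΦ

/-! ## §2 All blocks: the top bound and the cost bound from the budget -/

variable {ι : Type*}

/-- **THE TOP BOUND `α·M∕Φ² ≤ 1∕2`.**  With `m_r = (c_r∕2)Φt_r∕ℓ_r`, tops `ℓ_r ≥ α`, top speeds `Φt_r ≤ Φa` and the BUDGET `Σ_r c_r ≤ Φa`: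
`α·(Σ_r m_r)∕Φa² ≤ 1∕2` — the memory's level-derivative times the level is at most half the speed squared (used at every window top in `K_le`). [folklore] -/
theorem top_le_half (s : Finset ι) {α Φa : ℝ} {ℓ Φt c m : ι → ℝ} (hα : 0 < α) (hΦa : 0 < Φa) (hαℓ : ∀ r ∈ s, α ≤ ℓ r)
    (hΦt : ∀ r ∈ s, 0 < Φt r) (hΦta : ∀ r ∈ s, Φt r ≤ Φa) (hc : ∀ r ∈ s, 0 ≤ c r) (hm : ∀ r ∈ s, m r = c r / 2 * (Φt r / ℓ r))
    (hbudget : ∑ r ∈ s, c r ≤ Φa) : α * (∑ r ∈ s, m r) / Φa ^ 2 ≤ 1 / 2 := by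
  have hterm : ∀ r ∈ s, α * m r / Φa ^ 2 ≤ c r / (2 * Φa) := by
    intro r hr
    have hℓ : 0 < ℓ r := lt_of_lt_of_le hα (hαℓ r hr)
    have e1 : α * m r / Φa ^ 2 = c r / (2 * Φa) * ((α / ℓ r) * (Φt r / Φa)) := by
      rw [hm r hr]; field_simp
    rw [e1]
    have hx : α / ℓ r ≤ 1 := (div_le_one hℓ).mpr (hαℓ r hr)
    have hy : Φt r / Φa ≤ 1 := (div_le_one hΦa).mpr (hΦta r hr)
    have hcr : 0 ≤ c r / (2 * Φa) := by have := hc r hr; positivity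
    calc c r / (2 * Φa) * (α / ℓ r * (Φt r / Φa)) ≤ c r / (2 * Φa) * (1 * 1) := by
          apply mul_le_mul_of_nonneg_left _ hcr
          exact mul_le_mul hx hy (by have := hΦt r hr; positivity) zero_le_one
      _ = c r / (2 * Φa) := by ring
  calc α * (∑ r ∈ s, m r) / Φa ^ 2 = ∑ r ∈ s, α * m r / Φa ^ 2 := by rw [mul_sum, sum_div]
    _ ≤ ∑ r ∈ s, c r / (2 * Φa) := sum_le_sum hterm
    _ = (∑ r ∈ s, c r) / (2 * Φa) := by rw [sum_div]
    _ ≤ Φa / (2 * Φa) := div_le_div_of_nonneg_right hbudget (by positivity)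
    _ = 1 / 2 := by field_simp

/-- **THE COST BOUND `COST ≤ 5∕8 + β̄∕4`.**  Blocks `r ∈ s` as in `block_cost_le` (tops `ℓ_r ≥ α`, speeds `0 < Φt_r ≤ Φa`, `m_r = (c_r∕2)Φt_r∕ℓ_r`,
`K_r ≤ (2+β̄)Φt_r∕ℓ_r`, `0 ≤ J_r ≤ (ℓ_r²−α²)∕(2Φt_r²)`) under the BUDGET `Σ_r c_r ≤ Φa`: the gauge cost
`α·(Σ_r m_r)∕Φa² + Σ_r m_rK_rJ_r∕Φa ≤ 5∕8 + β̄∕4`.  Numerically ≤ 0.525 on every tower base of the cell (README §4 (c)). [folklore] -/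
theorem cost_le (s : Finset ι) {α Φa β : ℝ} {ℓ Φt c m K J : ι → ℝ} (hα : 0 < α) (hΦa : 0 < Φa) (hβ : 0 ≤ β)
    (hαℓ : ∀ r ∈ s, α ≤ ℓ r) (hΦt : ∀ r ∈ s, 0 < Φt r) (hΦta : ∀ r ∈ s, Φt r ≤ Φa) (hc : ∀ r ∈ s, 0 ≤ c r)
    (hm : ∀ r ∈ s, m r = c r / 2 * (Φt r / ℓ r)) (hK : ∀ r ∈ s, K r ≤ (2 + β) * Φt r / ℓ r)
    (hJ0 : ∀ r ∈ s, 0 ≤ J r) (hJ : ∀ r ∈ s, J r ≤ (ℓ r ^ 2 - α ^ 2) / (2 * Φt r ^ 2)) (hbudget : ∑ r ∈ s, c r ≤ Φa) :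
    α * (∑ r ∈ s, m r) / Φa ^ 2 + ∑ r ∈ s, m r * K r * J r / Φa ≤ 5 / 8 + β / 4 := by
  have hsplit : α * (∑ r ∈ s, m r) / Φa ^ 2 + ∑ r ∈ s, m r * K r * J r / Φa
      = ∑ r ∈ s, (α * m r / Φa ^ 2 + m r * K r * J r / Φa) := by
    rw [mul_sum, sum_div, ← sum_add_distrib]
  rw [hsplit]
  calc ∑ r ∈ s, (α * m r / Φa ^ 2 + m r * K r * J r / Φa) ≤ ∑ r ∈ s, c r / Φa * (5 / 8 + β / 4) :=
        sum_le_sum fun r hr => block_cost_le hα (hαℓ r hr) (hΦt r hr) (hΦta r hr) (hc r hr) hβ (hm r hr) (hK r hr) (hJ0 r hr) (hJ r hr)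
    _ = (∑ r ∈ s, c r) / Φa * (5 / 8 + β / 4) := by rw [← sum_mul, sum_div]
    _ ≤ Φa / Φa * (5 / 8 + β / 4) := by
        apply mul_le_mul_of_nonneg_right _ (by positivity)
        exact div_le_div_of_nonneg_right hbudget hΦa.le
    _ = 5 / 8 + β / 4 := by rw [div_self hΦa.ne', one_mul]

/-! ## §3 The gauge step: `α·Z′ ≤ Z·COST`, hence `α·Z′ − Z ≤ −(3∕8 − β̄∕4)·Z` -/

/-- **THE ONE-SIDED BOUND ON THE DERIVATIVE.**  The derivative identity of the level-matched linear response (README §2 (1)):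
`Z′ = e′ + Σ_r (m_rK_r∕Φa)·W_r − Σ_r m_r·Zt_r∕(Φt_r·Φa) + (M∕Φa²)·Z`, `M = Σ_r m_r`, with the SIGN FACTS `e′ ≤ 0` (source non-increasing in the level), `Zt_r ≥ 0`
(response non-negative at the window tops — the induction hypothesis, or zero above the source), `m_r, K_r ≥ 0`, and the WINDOW BOUNDS `W_r ≤ (Z∕α)·J_r` (the gauge
above the pin), gives `α·Z′ ≤ Z·(α·M∕Φa² + Σ_r m_rK_rJ_r∕Φa)`. [folklore] -/
theorem gauge_deriv_le (s : Finset ι) {α Φa Z Zp ep : ℝ} {m K W J Zt Φt : ι → ℝ} (hα : 0 < α) (hΦa : 0 < Φa)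
    (hZp : Zp = ep + ∑ r ∈ s, m r * K r / Φa * W r - ∑ r ∈ s, m r * Zt r / (Φt r * Φa) + (∑ r ∈ s, m r) / Φa ^ 2 * Z)
    (hep : ep ≤ 0) (hm : ∀ r ∈ s, 0 ≤ m r) (hK : ∀ r ∈ s, 0 ≤ K r) (hZt : ∀ r ∈ s, 0 ≤ Zt r) (hΦt : ∀ r ∈ s, 0 < Φt r)
    (hW : ∀ r ∈ s, W r ≤ Z / α * J r) :
    α * Zp ≤ Z * (α * (∑ r ∈ s, m r) / Φa ^ 2 + ∑ r ∈ s, m r * K r * J r / Φa) := by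
  have hout : 0 ≤ ∑ r ∈ s, m r * Zt r / (Φt r * Φa) :=
    sum_nonneg fun r hr => by have := hm r hr; have := hZt r hr; have := hΦt r hr; positivity
  have hwin : ∑ r ∈ s, m r * K r / Φa * W r ≤ ∑ r ∈ s, m r * K r / Φa * (Z / α * J r) :=
    sum_le_sum fun r hr => mul_le_mul_of_nonneg_left (hW r hr) (by have := hm r hr; have := hK r hr; positivity)
  have h1 : Zp ≤ ∑ r ∈ s, m r * K r / Φa * (Z / α * J r) + (∑ r ∈ s, m r) / Φa ^ 2 * Z := by rw [hZp]; linarith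
  have e1 : α * (∑ r ∈ s, m r * K r / Φa * (Z / α * J r) + (∑ r ∈ s, m r) / Φa ^ 2 * Z)
      = Z * (α * (∑ r ∈ s, m r) / Φa ^ 2 + ∑ r ∈ s, m r * K r * J r / Φa) := by
    have : ∑ r ∈ s, m r * K r / Φa * (Z / α * J r) = Z / α * ∑ r ∈ s, m r * K r * J r / Φa := by
      rw [mul_sum]; exact sum_congr rfl fun r _ => by ring
    rw [this]; field_simp; ring
  calc α * Zp ≤ α * (∑ r ∈ s, m r * K r / Φa * (Z / α * J r) + (∑ r ∈ s, m r) / Φa ^ 2 * Z) :=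
        mul_le_mul_of_nonneg_left h1 hα.le
    _ = Z * (α * (∑ r ∈ s, m r) / Φa ^ 2 + ∑ r ∈ s, m r * K r * J r / Φa) := e1

/-- **THE GAUGE DECREASES STRICTLY WHILE `Z > 0`, AS SOON AS `β̄ < 3∕2`.**  Combining `gauge_deriv_le` with `cost_le` (all the block data as there, plus
`Z ≥ 0` at the pin): `α·Z′ − Z ≤ −(3∕8 − β̄∕4)·Z`, i.e. `(Z∕α)′ = (αZ′ − Z)∕α² ≤ −(3∕8 − β̄∕4)·(Z∕α)∕α`.  This is the inequality the continuous induction of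
README §2 (4) propagates from the top of the source's support down to every pin. [folklore] -/
theorem gauge_decreasing (s : Finset ι) {α Φa β Z Zp ep : ℝ} {ℓ Φt c m K W J Zt : ι → ℝ} (hα : 0 < α) (hΦa : 0 < Φa) (hβ : 0 ≤ β) (hZ : 0 ≤ Z)
    (hZp : Zp = ep + ∑ r ∈ s, m r * K r / Φa * W r - ∑ r ∈ s, m r * Zt r / (Φt r * Φa) + (∑ r ∈ s, m r) / Φa ^ 2 * Z)
    (hep : ep ≤ 0) (hK0 : ∀ r ∈ s, 0 ≤ K r) (hZt : ∀ r ∈ s, 0 ≤ Zt r) (hW : ∀ r ∈ s, W r ≤ Z / α * J r)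
    (hαℓ : ∀ r ∈ s, α ≤ ℓ r) (hΦt : ∀ r ∈ s, 0 < Φt r) (hΦta : ∀ r ∈ s, Φt r ≤ Φa) (hc : ∀ r ∈ s, 0 ≤ c r)
    (hm : ∀ r ∈ s, m r = c r / 2 * (Φt r / ℓ r)) (hK : ∀ r ∈ s, K r ≤ (2 + β) * Φt r / ℓ r)
    (hJ0 : ∀ r ∈ s, 0 ≤ J r) (hJ : ∀ r ∈ s, J r ≤ (ℓ r ^ 2 - α ^ 2) / (2 * Φt r ^ 2)) (hbudget : ∑ r ∈ s, c r ≤ Φa) :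
    α * Zp - Z ≤ -(3 / 8 - β / 4) * Z := by
  have hm0 : ∀ r ∈ s, 0 ≤ m r := fun r hr => by
    rw [hm r hr]; have := hc r hr; have := hΦt r hr; have := lt_of_lt_of_le hα (hαℓ r hr); positivity
  have h1 := gauge_deriv_le s hα hΦa hZp hep hm0 hK0 hZt hΦt hW
  have h2 := cost_le s hα hΦa hβ hαℓ hΦt hΦta hc hm hK hJ0 hJ hbudget
  have h3 : Z * (α * (∑ r ∈ s, m r) / Φa ^ 2 + ∑ r ∈ s, m r * K r * J r / Φa) ≤ Z * (5 / 8 + β / 4) :=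
    mul_le_mul_of_nonneg_left h2 hZ
  linarith

/-! ## §4 (v1.1) A general coefficient: the extra kernel block of a soft `u_J`-onset -/

/-- `x∕2 + κ(1−x²)∕4 ≤ κ∕4 + 1∕(4κ)` for `κ > 0` (the difference is `−(κx − 1)²∕(4κ)`); `κ = 2` gives `quad_le`'s `5∕8`. [folklore] -/
theorem quad_le_gen {x κ : ℝ} (hκ : 0 < κ) : x / 2 + κ * (1 - x ^ 2) / 4 ≤ κ / 4 + 1 / (4 * κ) := by
  have h : x / 2 + κ * (1 - x ^ 2) / 4 - (κ / 4 + 1 / (4 * κ)) = -(κ * x - 1) ^ 2 / (4 * κ) := by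
    field_simp; ring
  have h2 : -(κ * x - 1) ^ 2 / (4 * κ) ≤ 0 :=
    div_nonpos_of_nonpos_of_nonneg (neg_nonpos.mpr (sq_nonneg _)) (by positivity)
  linarith

/-- **THE COST OF ONE BLOCK WITH A GENERAL COEFFICIENT.**  As `block_cost_le`, but with `K ≤ κ·Φt∕ℓ` for any `κ > 0` (for the memory blocks `κ = 2 + β̄` by `K_le`;
for the extra kernel block `m_ex = η|e′(ℓ_J)|Φ(ℓ_J)` produced by the amplitude homotopy of a smooth `u_J`-excess, `κ = p′ + 3∕2 + β̄` with `p′ = sup ℓ|d ln|e′|∕dℓ| − 1`,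
README §3 (e)): `α·m∕Φa² + m·K·J∕Φa ≤ (c∕Φa)·(κ∕4 + 1∕(4κ))`. [folklore] -/
theorem block_cost_le_gen {α ℓ Φa Φt c m K J κ : ℝ} (hα : 0 < α) (hαℓ : α ≤ ℓ) (hΦt : 0 < Φt) (hΦta : Φt ≤ Φa) (hc : 0 ≤ c) (hκ : 0 < κ)
    (hm : m = c / 2 * (Φt / ℓ)) (hK : K ≤ κ * Φt / ℓ) (hJ0 : 0 ≤ J) (hJ : J ≤ (ℓ ^ 2 - α ^ 2) / (2 * Φt ^ 2)) :
    α * m / Φa ^ 2 + m * K * J / Φa ≤ c / Φa * (κ / 4 + 1 / (4 * κ)) := by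
  have hℓ : 0 < ℓ := lt_of_lt_of_le hα hαℓ
  have hΦa : 0 < Φa := lt_of_lt_of_le hΦt hΦta
  have hm0 : 0 ≤ m := by rw [hm]; positivity
  have h1 : α * m / Φa ^ 2 ≤ c / Φa * (α / (2 * ℓ)) := by
    have e1 : α * m / Φa ^ 2 = c / Φa * (α / (2 * ℓ)) * (Φt / Φa) := by
      rw [hm]; field_simp
    rw [e1]
    calc c / Φa * (α / (2 * ℓ)) * (Φt / Φa) ≤ c / Φa * (α / (2 * ℓ)) * 1 :=
          mul_le_mul_of_nonneg_left ((div_le_one hΦa).mpr hΦta) (by positivity)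
      _ = c / Φa * (α / (2 * ℓ)) := mul_one _
  have h2 : m * K * J / Φa ≤ c / Φa * (κ * (1 - (α / ℓ) ^ 2) / 4) := by
    have s1 : m * K * J ≤ m * (κ * Φt / ℓ) * J := by
      have := mul_le_mul_of_nonneg_left hK (mul_nonneg hm0 hJ0)
      nlinarith [this]
    have s2 : m * (κ * Φt / ℓ) * J ≤ m * (κ * Φt / ℓ) * ((ℓ ^ 2 - α ^ 2) / (2 * Φt ^ 2)) :=
      mul_le_mul_of_nonneg_left hJ (by positivity)
    have e2 : m * (κ * Φt / ℓ) * ((ℓ ^ 2 - α ^ 2) / (2 * Φt ^ 2)) / Φa = c / Φa * (κ * (1 - (α / ℓ) ^ 2) / 4) := by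
      rw [hm]; field_simp; ring
    calc m * K * J / Φa ≤ m * (κ * Φt / ℓ) * ((ℓ ^ 2 - α ^ 2) / (2 * Φt ^ 2)) / Φa :=
          div_le_div_of_nonneg_right (s1.trans s2) hΦa.le
      _ = c / Φa * (κ * (1 - (α / ℓ) ^ 2) / 4) := e2
  have h3 : α / (2 * ℓ) + κ * (1 - (α / ℓ) ^ 2) / 4 ≤ κ / 4 + 1 / (4 * κ) := by
    have : α / (2 * ℓ) = (α / ℓ) / 2 := by field_simp
    rw [this]; exact quad_le_gen hκ
  have hcΦ : 0 ≤ c / Φa := div_nonneg hc hΦa.le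
  calc α * m / Φa ^ 2 + m * K * J / Φa ≤ c / Φa * (α / (2 * ℓ)) + c / Φa * (κ * (1 - (α / ℓ) ^ 2) / 4) := add_le_add h1 h2
    _ = c / Φa * (α / (2 * ℓ) + κ * (1 - (α / ℓ) ^ 2) / 4) := by ring
    _ ≤ c / Φa * (κ / 4 + 1 / (4 * κ)) := mul_le_mul_of_nonneg_left h3 hcΦ

end Summit.QuantumFields.BalabanUV.Beta.EriceRemainderEnclosureHistoryAutonomyComparisonContinuumGaugeCost

end
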